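import Mathlib.MeasureTheory.Measure.LevyConvergence
import Mathlib.MeasureTheory.Group.Convolution
import Mathlib.Algebra.BigOperators.Fin
import Literature.Probability.LatticeModels.IsingLimitLawLaplace
import HarnessLib

/-!
# Ising limit laws are closed under convolution (independent juxtaposition of ferromagnets)

Trunk T-STATMECH (`Literature/Probability/LatticeModels`), companion of `IsingLimitLaw.lean`
(route RiemannHypothesis/LeeYang, two-layer plan S1, case of uncoupled blocks; crux dossier
`Cruxes/LeeyangNeg`: the class `IsIsingLimitLaw` contains all symmetric convolutions of its members).

* `blockCoupling J₁ J₂` — the block-diagonal coupling matrix on `Fin (m + n)` of two systems placed side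
  by side with NO coupling between the blocks; `Fin.append w₁ w₂` the juxtaposed weights.
* `isingFieldPartition_block` — the partition function in a field factorises: `Z(z) = Z₁(z) Z₂(z)`.
* `charFun_isingMagnetizationLaw` — `charFun (law J w) t = Z(it)/Z(0)`.
* `isingMagnetizationLaw_block` — the magnetization law of the juxtaposed system is the CONVOLUTION
  `law J₁ w₁ ∗ law J₂ w₂` (independence of uncoupled blocks; proved through characteristic functions,
  `Measure.ext_of_charFun`).
* `IsIsingLimitLaw.conv` — hence the class of Ising limit laws is closed under convolution: witnesses are
  juxtaposed, weak convergence passes to convolutions by Lévy's continuity theorem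
  (`ProbabilityMeasure.tendsto_iff_tendsto_charFun`, `charFun_conv`), and the Gaussian-exponential moment
  bounds multiply (`e^{b(u+v)²} ≤ e^{2b⁺u²} e^{2b⁺v²}`).

## References

* C. M. Newman, *Zeros of the partition function for generalized Ising systems*, CPAM 27 (1974)
  143–159, §1 (products of Lee–Yang measures are Lee–Yang; juxtaposition of systems).
* E. H. Lieb, A. D. Sokal, CMP 80 (1981) 153–179, §2 (closure properties of the class).
* B. Simon, R. B. Griffiths, CMP 33 (1973) 145–164, §II (block constructions).
-/

noncomputable section

open MeasureTheory Filter Topology Complex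
open scoped BigOperators

namespace Literature.Probability.LatticeModels

variable {m n : ℕ}

/-! ### Juxtaposition of two finite systems -/

/-- **Block-diagonal couplings**: two finite systems with couplings `J₁` (on `Fin m`) and `J₂` (on
`Fin n`) placed side by side on `Fin (m + n)`, with zero coupling between the blocks.
[Newman 1974, §1] [folklore] -/
def blockCoupling (J₁ : Fin m → Fin m → ℝ) (J₂ : Fin n → Fin n → ℝ) :
    Fin (m + n) → Fin (m + n) → ℝ := fun i j =>
  Fin.addCases (motive := fun _ => ℝ)
    (fun i₁ => Fin.addCases (motive := fun _ => ℝ) (fun j₁ => J₁ i₁ j₁) (fun _ => 0) j)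
    (fun i₂ => Fin.addCases (motive := fun _ => ℝ) (fun _ => 0) (fun j₂ => J₂ i₂ j₂) j) i

/-- Left–left block of `blockCoupling` is `J₁`. [folklore] -/
@[simp] theorem blockCoupling_castAdd_castAdd (J₁ : Fin m → Fin m → ℝ) (J₂ : Fin n → Fin n → ℝ)
    (i j : Fin m) : blockCoupling J₁ J₂ (Fin.castAdd n i) (Fin.castAdd n j) = J₁ i j := by
  simp [blockCoupling]

/-- Left–right block of `blockCoupling` vanishes. [folklore] -/
@[simp] theorem blockCoupling_castAdd_natAdd (J₁ : Fin m → Fin m → ℝ) (J₂ : Fin n → Fin n → ℝ)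
    (i : Fin m) (j : Fin n) : blockCoupling J₁ J₂ (Fin.castAdd n i) (Fin.natAdd m j) = 0 := by
  simp [blockCoupling]

/-- Right–left block of `blockCoupling` vanishes. [folklore] -/
@[simp] theorem blockCoupling_natAdd_castAdd (J₁ : Fin m → Fin m → ℝ) (J₂ : Fin n → Fin n → ℝ)
    (i : Fin n) (j : Fin m) : blockCoupling J₁ J₂ (Fin.natAdd m i) (Fin.castAdd n j) = 0 := by
  simp [blockCoupling]

/-- Right–right block of `blockCoupling` is `J₂`. [folklore] -/
@[simp] theorem blockCoupling_natAdd_natAdd (J₁ : Fin m → Fin m → ℝ) (J₂ : Fin n → Fin n → ℝ)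
    (i j : Fin n) : blockCoupling J₁ J₂ (Fin.natAdd m i) (Fin.natAdd m j) = J₂ i j := by
  simp [blockCoupling]

/-- Block-diagonal couplings of two ferromagnets are ferromagnetic. [folklore] -/
theorem blockCoupling_nonneg {J₁ : Fin m → Fin m → ℝ} {J₂ : Fin n → Fin n → ℝ}
    (h₁ : ∀ i j, 0 ≤ J₁ i j) (h₂ : ∀ i j, 0 ≤ J₂ i j) (i j : Fin (m + n)) :
    0 ≤ blockCoupling J₁ J₂ i j := by
  induction i using Fin.addCases <;> induction j using Fin.addCases <;> simp [h₁, h₂]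

/-- Juxtaposed non-negative weights are non-negative. [folklore] -/
theorem append_nonneg {w₁ : Fin m → ℝ} {w₂ : Fin n → ℝ} (h₁ : ∀ i, 0 ≤ w₁ i) (h₂ : ∀ i, 0 ≤ w₂ i)
    (i : Fin (m + n)) : 0 ≤ Fin.append w₁ w₂ i := by
  induction i using Fin.addCases <;> simp [h₁, h₂]

/-- Spins of a juxtaposed configuration, left block. [folklore] -/
@[simp] theorem spinVal_append_castAdd (s₁ : Fin m → Bool) (s₂ : Fin n → Bool) (i : Fin m) :
    spinVal (Fin.append s₁ s₂) (Fin.castAdd n i) = spinVal s₁ i := by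
  simp [spinVal]

/-- Spins of a juxtaposed configuration, right block. [folklore] -/
@[simp] theorem spinVal_append_natAdd (s₁ : Fin m → Bool) (s₂ : Fin n → Bool) (i : Fin n) :
    spinVal (Fin.append s₁ s₂) (Fin.natAdd m i) = spinVal s₂ i := by
  simp [spinVal]

/-- The energy of uncoupled blocks is additive. [Newman 1974, §1] [folklore] -/
theorem isingPairEnergy_block (J₁ : Fin m → Fin m → ℝ) (J₂ : Fin n → Fin n → ℝ)
    (s₁ : Fin m → Bool) (s₂ : Fin n → Bool) :
    isingPairEnergy (blockCoupling J₁ J₂) (Fin.append s₁ s₂) =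
      isingPairEnergy J₁ s₁ + isingPairEnergy J₂ s₂ := by
  simp only [isingPairEnergy, Fin.sum_univ_add, blockCoupling_castAdd_castAdd,
    blockCoupling_castAdd_natAdd, blockCoupling_natAdd_castAdd, blockCoupling_natAdd_natAdd,
    spinVal_append_castAdd, spinVal_append_natAdd, zero_mul, Finset.sum_const_zero, add_zero,
    zero_add]

/-- The weighted magnetization of juxtaposed blocks is additive. [folklore] -/
theorem weightedMagnetization_append (w₁ : Fin m → ℝ) (w₂ : Fin n → ℝ)
    (s₁ : Fin m → Bool) (s₂ : Fin n → Bool) :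
    weightedMagnetization (Fin.append w₁ w₂) (Fin.append s₁ s₂) =
      weightedMagnetization w₁ s₁ + weightedMagnetization w₂ s₂ := by
  simp only [weightedMagnetization, Fin.sum_univ_add, Fin.append_left, Fin.append_right,
    spinVal_append_castAdd, spinVal_append_natAdd]

/-- Configurations of the juxtaposed system are pairs of configurations. [folklore] -/
def appendConfigEquiv (m n : ℕ) : (Fin m → Bool) × (Fin n → Bool) ≃ (Fin (m + n) → Bool) where
  toFun p := Fin.append p.1 p.2
  invFun s := (fun i => s (Fin.castAdd n i), fun j => s (Fin.natAdd m j))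
  left_inv p := by ext i <;> simp
  right_inv s := Fin.append_castAdd_natAdd

/-- Sums over configurations of the juxtaposed system are double sums. [folklore] -/
theorem sum_config_append {M : Type*} [AddCommMonoid M] (f : (Fin (m + n) → Bool) → M) :
    ∑ s, f s = ∑ s₁ : Fin m → Bool, ∑ s₂ : Fin n → Bool, f (Fin.append s₁ s₂) := by
  rw [← Fintype.sum_prod_type']
  exact (Fintype.sum_equiv (appendConfigEquiv m n) _ _ fun _ => rfl).symm

/-- **The partition function of uncoupled blocks factorises**: `Z(z) = Z₁(z) Z₂(z)`.
[Newman 1974, §1] [folklore] -/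
theorem isingFieldPartition_block (J₁ : Fin m → Fin m → ℝ) (J₂ : Fin n → Fin n → ℝ)
    (w₁ : Fin m → ℝ) (w₂ : Fin n → ℝ) (z : ℂ) :
    isingFieldPartition (blockCoupling J₁ J₂) (Fin.append w₁ w₂) z =
      isingFieldPartition J₁ w₁ z * isingFieldPartition J₂ w₂ z := by
  unfold isingFieldPartition
  rw [sum_config_append, Finset.sum_mul_sum]
  refine Finset.sum_congr rfl fun s₁ _ => Finset.sum_congr rfl fun s₂ _ => ?_
  rw [isingBoltzmann, isingPairEnergy_block, weightedMagnetization_append, Real.exp_add,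
    isingBoltzmann, isingBoltzmann]
  push_cast
  rw [mul_add, Complex.exp_add]
  ring

/-- The zero-field partition function of uncoupled blocks factorises. [folklore] -/
theorem isingPairPartition_block (J₁ : Fin m → Fin m → ℝ) (J₂ : Fin n → Fin n → ℝ) :
    isingPairPartition (blockCoupling J₁ J₂) = isingPairPartition J₁ * isingPairPartition J₂ := by
  have h := isingFieldPartition_block J₁ J₂ (fun _ => 0) (fun _ => 0) 0
  rw [isingFieldPartition_zero, isingFieldPartition_zero, isingFieldPartition_zero] at h
  exact_mod_cast h

/-! ### The magnetization law of uncoupled blocks is a convolution -/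

/-- **Characteristic function of a magnetization law**: `E e^{itM} = Z(it)/Z(0)`.
[Newman 1974, eq. (1.1)–(1.2)] [folklore] -/
theorem charFun_isingMagnetizationLaw (J : Fin n → Fin n → ℝ) (w : Fin n → ℝ) (t : ℝ) :
    charFun (isingMagnetizationLaw n J w : Measure ℝ) t =
      isingFieldPartition J w (t * I) / isingPairPartition J := by
  rw [charFun_apply_real, ← integral_exp_isingMagnetizationLaw]
  refine integral_congr_ae (Eventually.of_forall fun u => ?_)
  simp only [mul_right_comm (t : ℂ) u I]

/-- **Independence of uncoupled blocks**: the magnetization law of two juxtaposed, uncoupled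
finite systems is the convolution of their magnetization laws. [Newman 1974, §1] [folklore] -/
theorem isingMagnetizationLaw_block (J₁ : Fin m → Fin m → ℝ) (J₂ : Fin n → Fin n → ℝ)
    (w₁ : Fin m → ℝ) (w₂ : Fin n → ℝ) :
    (isingMagnetizationLaw (m + n) (blockCoupling J₁ J₂) (Fin.append w₁ w₂) : Measure ℝ) =
      (isingMagnetizationLaw m J₁ w₁ : Measure ℝ) ∗ (isingMagnetizationLaw n J₂ w₂ : Measure ℝ) := by
  refine Measure.ext_of_charFun (funext fun t => ?_)
  rw [charFun_conv, charFun_isingMagnetizationLaw, charFun_isingMagnetizationLaw,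
    charFun_isingMagnetizationLaw, isingFieldPartition_block, isingPairPartition_block]
  push_cast
  rw [div_mul_div_comm]

/-- The same as an identity of probability measures. [folklore] -/
theorem isingMagnetizationLaw_block' (J₁ : Fin m → Fin m → ℝ) (J₂ : Fin n → Fin n → ℝ)
    (w₁ : Fin m → ℝ) (w₂ : Fin n → ℝ) :
    isingMagnetizationLaw (m + n) (blockCoupling J₁ J₂) (Fin.append w₁ w₂) =
      ⟨(isingMagnetizationLaw m J₁ w₁ : Measure ℝ) ∗ (isingMagnetizationLaw n J₂ w₂ : Measure ℝ),
        inferInstance⟩ := by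
  apply ProbabilityMeasure.toMeasure_injective
  exact isingMagnetizationLaw_block J₁ J₂ w₁ w₂

/-! ### Gaussian-exponential moments of a convolution -/

/-- `e^{b(u+v)²} ≤ e^{2b⁺u²} e^{2b⁺v²}` with `b⁺ = max b 0`. [folklore] -/
theorem exp_mul_add_sq_le (b u v : ℝ) :
    Real.exp (b * (u + v) ^ 2) ≤
      Real.exp (2 * max b 0 * u ^ 2) * Real.exp (2 * max b 0 * v ^ 2) := by
  rw [← Real.exp_add]
  refine Real.exp_monotone ?_
  have hb : b ≤ max b 0 := le_max_left _ _
  have hb0 : 0 ≤ max b 0 := le_max_right _ _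
  have h1 : b * (u + v) ^ 2 ≤ max b 0 * (u + v) ^ 2 :=
    mul_le_mul_of_nonneg_right hb (sq_nonneg _)
  have h2 : max b 0 * (u + v) ^ 2 ≤ max b 0 * (2 * u ^ 2 + 2 * v ^ 2) :=
    mul_le_mul_of_nonneg_left (by nlinarith [sq_nonneg (u - v)]) hb0
  linarith

/-- **Gaussian-exponential moments multiply under convolution**: if `∫ e^{2b⁺u²} dμ ≤ C₁` and
`∫ e^{2b⁺v²} dν ≤ C₂` for finite magnetization laws `μ, ν`, then `∫ e^{bu²} d(μ ∗ ν) ≤ C₁ C₂`.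
[folklore] -/
theorem integral_exp_mul_sq_conv_le {m n : ℕ} (J₁ : Fin m → Fin m → ℝ) (w₁ : Fin m → ℝ)
    (J₂ : Fin n → Fin n → ℝ) (w₂ : Fin n → ℝ) (b : ℝ) {C₁ C₂ : ℝ}
    (h₁ : ∫ u, Real.exp (2 * max b 0 * u ^ 2) ∂(isingMagnetizationLaw m J₁ w₁ : Measure ℝ) ≤ C₁)
    (h₂ : ∫ u, Real.exp (2 * max b 0 * u ^ 2) ∂(isingMagnetizationLaw n J₂ w₂ : Measure ℝ) ≤ C₂) :
    ∫ u, Real.exp (b * u ^ 2) ∂((isingMagnetizationLaw m J₁ w₁ : Measure ℝ) ∗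
        (isingMagnetizationLaw n J₂ w₂ : Measure ℝ)) ≤ C₁ * C₂ := by
  set μ : Measure ℝ := (isingMagnetizationLaw m J₁ w₁ : Measure ℝ) with hμ
  set ν : Measure ℝ := (isingMagnetizationLaw n J₂ w₂ : Measure ℝ) with hν
  set B : ℝ := 2 * max b 0 with hB
  have hI₁ : Integrable (fun u : ℝ => Real.exp (B * u ^ 2)) μ :=
    integrable_isingMagnetizationLaw J₁ w₁ (by fun_prop : Continuous _).stronglyMeasurable
  have hI₂ : Integrable (fun u : ℝ => Real.exp (B * u ^ 2)) ν :=
    integrable_isingMagnetizationLaw J₂ w₂ (by fun_prop : Continuous _).stronglyMeasurable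
  have h0₁ : 0 ≤ ∫ u, Real.exp (B * u ^ 2) ∂μ := integral_nonneg fun _ => (Real.exp_pos _).le
  have h0₂ : 0 ≤ ∫ u, Real.exp (B * u ^ 2) ∂ν := integral_nonneg fun _ => (Real.exp_pos _).le
  have hC₁ : 0 ≤ C₁ := h0₁.trans h₁
  -- pass to the lower integral, where the convolution unfolds without integrability side conditions
  have hmeas : Measurable fun u : ℝ => ENNReal.ofReal (Real.exp (b * u ^ 2)) :=
    (by fun_prop : Continuous fun u : ℝ => Real.exp (b * u ^ 2)).measurable.ennreal_ofReal
  have hle : ∫⁻ u, ENNReal.ofReal (Real.exp (b * u ^ 2)) ∂(μ ∗ ν) ≤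
      ENNReal.ofReal (∫ u, Real.exp (B * u ^ 2) ∂μ) * ENNReal.ofReal (∫ u, Real.exp (B * u ^ 2) ∂ν) := by
    rw [Measure.lintegral_conv hmeas]
    calc ∫⁻ x, ∫⁻ y, ENNReal.ofReal (Real.exp (b * (x + y) ^ 2)) ∂ν ∂μ
        ≤ ∫⁻ x, ∫⁻ y, ENNReal.ofReal (Real.exp (B * x ^ 2)) * ENNReal.ofReal (Real.exp (B * y ^ 2)) ∂ν ∂μ := by
          refine lintegral_mono fun x => lintegral_mono fun y => ?_
          rw [← ENNReal.ofReal_mul (Real.exp_pos _).le]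
          exact ENNReal.ofReal_le_ofReal (exp_mul_add_sq_le b x y)
      _ = (∫⁻ x, ENNReal.ofReal (Real.exp (B * x ^ 2)) ∂μ) *
            ∫⁻ y, ENNReal.ofReal (Real.exp (B * y ^ 2)) ∂ν := by
          rw [← lintegral_mul_const _ ((by fun_prop : Continuous fun u : ℝ =>
            Real.exp (B * u ^ 2)).measurable.ennreal_ofReal)]
          refine lintegral_congr fun x => ?_
          rw [lintegral_const_mul _ ((by fun_prop : Continuous fun u : ℝ =>
            Real.exp (B * u ^ 2)).measurable.ennreal_ofReal)]
      _ = ENNReal.ofReal (∫ u, Real.exp (B * u ^ 2) ∂μ) *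
            ENNReal.ofReal (∫ u, Real.exp (B * u ^ 2) ∂ν) := by
          rw [ofReal_integral_eq_lintegral_ofReal hI₁ (Eventually.of_forall fun _ => (Real.exp_pos _).le),
            ofReal_integral_eq_lintegral_ofReal hI₂ (Eventually.of_forall fun _ => (Real.exp_pos _).le)]
  have hfin : ENNReal.ofReal (∫ u, Real.exp (B * u ^ 2) ∂μ) *
      ENNReal.ofReal (∫ u, Real.exp (B * u ^ 2) ∂ν) ≠ ⊤ :=
    ENNReal.mul_ne_top ENNReal.ofReal_ne_top ENNReal.ofReal_ne_top
  rw [integral_eq_lintegral_of_nonneg_ae (Eventually.of_forall fun _ => (Real.exp_pos _).le)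
    (by fun_prop : Continuous fun u : ℝ => Real.exp (b * u ^ 2)).aestronglyMeasurable]
  calc (∫⁻ u, ENNReal.ofReal (Real.exp (b * u ^ 2)) ∂(μ ∗ ν)).toReal
      ≤ (ENNReal.ofReal (∫ u, Real.exp (B * u ^ 2) ∂μ) *
          ENNReal.ofReal (∫ u, Real.exp (B * u ^ 2) ∂ν)).toReal := ENNReal.toReal_mono hfin hle
    _ = (∫ u, Real.exp (B * u ^ 2) ∂μ) * ∫ u, Real.exp (B * u ^ 2) ∂ν := by
        rw [ENNReal.toReal_mul, ENNReal.toReal_ofReal h0₁, ENNReal.toReal_ofReal h0₂]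
    _ ≤ C₁ * C₂ := mul_le_mul h₁ h₂ h0₂ hC₁

/-! ### Closure of the class under convolution -/

/-- **Ising limit laws are closed under convolution.** If `ν₁` and `ν₂` are Ising limit laws then so
is `ν₁ ∗ ν₂` (the law of the sum of two INDEPENDENT weighted magnetizations): juxtapose the witnessing
ferromagnets with no coupling between them; the finite laws are the convolutions of the finite laws
(`isingMagnetizationLaw_block`), they converge weakly to `ν₁ ∗ ν₂` by Lévy's continuity theorem
(`charFun_conv`), and the Gaussian-exponential moment bounds multiply.
[Newman 1974, §1; Lieb–Sokal 1981, §2 (closure properties)] [cite: Newman1974, §1] -/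
theorem IsIsingLimitLaw.conv {ν₁ ν₂ : ProbabilityMeasure ℝ} (h₁ : IsIsingLimitLaw ν₁)
    (h₂ : IsIsingLimitLaw ν₂) :
    IsIsingLimitLaw ⟨(ν₁ : Measure ℝ) ∗ (ν₂ : Measure ℝ), inferInstance⟩ := by
  obtain ⟨n₁, J₁, w₁, hJ₁, hw₁, ht₁, hb₁⟩ := h₁
  obtain ⟨n₂, J₂, w₂, hJ₂, hw₂, ht₂, hb₂⟩ := h₂
  refine ⟨fun k => n₁ k + n₂ k, fun k => blockCoupling (J₁ k) (J₂ k),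
    fun k => Fin.append (w₁ k) (w₂ k), fun k => blockCoupling_nonneg (hJ₁ k) (hJ₂ k),
    fun k => append_nonneg (hw₁ k) (hw₂ k), ?_, fun b => ?_⟩
  · -- weak convergence, by Lévy's continuity theorem
    have hfun : (fun k => isingMagnetizationLaw (n₁ k + n₂ k) (blockCoupling (J₁ k) (J₂ k))
        (Fin.append (w₁ k) (w₂ k))) = fun k =>
          (⟨(isingMagnetizationLaw (n₁ k) (J₁ k) (w₁ k) : Measure ℝ) ∗
            (isingMagnetizationLaw (n₂ k) (J₂ k) (w₂ k) : Measure ℝ), inferInstance⟩ :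
              ProbabilityMeasure ℝ) :=
      funext fun k => isingMagnetizationLaw_block' _ _ _ _
    rw [hfun]
    rw [ProbabilityMeasure.tendsto_iff_tendsto_charFun] at ht₁ ht₂ ⊢
    intro t
    simp only [ProbabilityMeasure.coe_mk, charFun_conv]
    exact (ht₁ t).mul (ht₂ t)
  · -- Gaussian-exponential moments
    obtain ⟨C₁, hC₁⟩ := hb₁ (2 * max b 0)
    obtain ⟨C₂, hC₂⟩ := hb₂ (2 * max b 0)
    refine ⟨C₁ * C₂, fun k => ?_⟩
    rw [isingMagnetizationLaw_block']
    exact integral_exp_mul_sq_conv_le (J₁ k) (w₁ k) (J₂ k) (w₂ k) b (hC₁ k) (hC₂ k)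

end Literature.Probability.LatticeModels

end
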